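import Summits.QuantumAdvantage.QuantumAdvantage.Theorems.CubicForrelationNearExactIsExactTwelveLevelSixGammaH3

/-!
# Crux `CubicForrelation.NearExactIsExact` (stmt-QuantumAdvantage-14043) — n = 12 AT `Φ = 29/32`, level-6 configuration (γ):
  the RANK-6 case is dead — a 7-flat through a NON-DEGENERATE 4-flat of the 9-flat whose translates miss the bad 6-flat

Certificate seat `b2b-cforr-cert` (gen 25).  HONEST FRAMING: finite-slice lemmas (standard axioms; `decide` only on closed Boolean identities
in ≤ 6 variables) about cubic Boolean pairs on 12 bits; fourth brick for killing configuration (γ) of `tw23_boundary_reduction2` (plan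
HOME/b2b-cforr-cert-g25/PROOF-N12-928-GAMMA.md).  It does NOT decide (γ) by itself and claims NO value of `θ₁₂`.  NOT summit progress.

Setting (`gf_rank_six_false`): cubic `f, g`, `W_g = 64u''`, `Z = {u'' even} = x_Z ⊕ V₀` a 9-flat, `e = u'' − (−1)^f = sZ∘hb` on `Z`
(quadratic along `Z` by `gh_H3` + `fr_hsd`; relative form `B`, radical `R`), off `Z` the residual vanishes outside `m₀ ⊕ U` (`U ≤ V₀` an
xor-closed 64-set, `m₀ ∉ Z`), and `#R = 8` (rank 6 — the only case left open by `gr_radical_eq_eight`).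
* `gf_witness`, `gf_B_smul_right`, `gf_B_add_right`, `gf_pair10`, `gf_proj`: symplectic bookkeeping for `B` along `V₀`.
* `gf_frame`: there are `p, q ∈ U` and `a₂, a₃ ∈ V₀` with Gram–PFAFFIAN `1` (`#U = 64 > 16` gives `p, q ∈ U` with `p, q, p⊕q ∉ R`; if
  `B(p,q) = 0` complete by `(1,0)`- and `(0,1)`-vectors, if `B(p,q) = 1` by a hyperbolic pair inside `⟨p,q⟩^⊥`, found with the projection
  `w ↦ w ⊕ B(q,w)p ⊕ B(p,w)q`, whose image is not inside `R` because `#R = 8 < 512/4`).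
* `gf_rank_six_false`: the 4-flat `x_Z ⊕ ⟨p,q,a₂,a₃⟩ ⊂ Z` has sign sum `≡ 4 (mod 8)` (`ws_sum4_mod8`); since `p, q` are periods of
  `m₀ ⊕ U`, some translate `q₀ ⊕ ⟨p,q,a₂,a₃⟩` inside the coset of `m₀` misses `m₀ ⊕ U` (`#(U ⊕ ⟨a₂,a₃⟩) ≤ 256 < 512`); the 7-flat
  `x_Z ⊕ ⟨x_Z ⊕ q₀, t₂, t₃, p, q, a₂, a₃⟩`, with `t₂, t₃` keeping the remaining translates off `Z` and off the coset of `m₀`, has all seven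
  translate families in the zero set of `e`; so (`ep_loc3`) its residual sum equals the 4-flat sign sum — contradicting `8 ∣ Σ_{7-flat} e`
  (`tw15_e_flat7`).

References: MacWilliams–Sloane (1977) Ch. 13 §3, Ch. 15 §2; C. Carlet (2021) §5.2.  Axioms: the standard three.
-/

set_option linter.dupNamespace false -- D-0017: single-problem summit ⇒ `QuantumAdvantage.QuantumAdvantage` by design

noncomputable section

namespace Summit.QuantumAdvantage.QuantumAdvantage.Theorems.CubicForrelation.NearExactIsExact

open Finset
open Literature.Computability.QuantumComplexity
open Literature.Computability.QuantumComplexity.BuzetChailloux (bxor zeroVec bxor_bxor_cancel_left bxor_zeroVec zeroVec_bxor bxor_comm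
  bxor_self)
open Literature.Computability.QuantumComplexity.DerivativeWalsh (W)

/-! ### Symplectic bookkeeping for the relative form `B` along `V₀` -/

/-- A vector of `V₀` outside the radical pairs non-trivially with some vector of `V₀`. [folklore] -/
theorem gf_witness (V₀ : Finset (Fin (6 + 6) → Bool)) (xZ : Fin (6 + 6) → Bool) (hb : (Fin (6 + 6) → Bool) → Bool)
    {p : Fin (6 + 6) → Bool} (hp : p ∈ V₀) (hpR : p ∉ (V₀.filter fun r => ∀ v ∈ V₀, (hb xZ ^^ hb (bxor xZ r) ^^ hb (bxor xZ v) ^^ hb (bxor (bxor xZ r) v)) = false)) :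
    ∃ v ∈ V₀, (hb xZ ^^ hb (bxor xZ p) ^^ hb (bxor xZ v) ^^ hb (bxor (bxor xZ p) v)) = true := by
  by_contra hno
  push Not at hno
  exact hpR (mem_filter.2 ⟨hp, fun v hv => by simpa using hno v hv⟩)

/-- `B(x, c·v) = c ∧ B(x,v)`. [folklore] -/
theorem gf_B_smul_right (xZ : Fin (6 + 6) → Bool) (hb : (Fin (6 + 6) → Bool) → Bool) (c : Bool) (x v : Fin (6 + 6) → Bool) :
    (hb xZ ^^ hb (bxor xZ x) ^^ hb (bxor xZ (fun j => c && v j)) ^^ hb (bxor (bxor xZ x) (fun j => c && v j))) = (c && (hb xZ ^^ hb (bxor xZ x) ^^ hb (bxor xZ v) ^^ hb (bxor (bxor xZ x) v))) := by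
  cases c
  · have h : (fun j => false && v j) = (zeroVec : Fin (6 + 6) → Bool) := funext fun j => by simp [zeroVec]
    rw [h, Bool.false_and, bxor_zeroVec, bxor_zeroVec]
    cases hb xZ <;> cases hb (bxor xZ x) <;> rfl
  · have h : (fun j => true && v j) = v := funext fun j => by simp
    rw [h, Bool.true_and]

/-- **Additivity of `B` in the second argument** (from `fr_B_add_left` and symmetry). [folklore] -/
theorem gf_B_add_right (V₀ : Finset (Fin (6 + 6) → Bool)) (P : (Fin (6 + 6) → Bool) → Prop) (xZ : Fin (6 + 6) → Bool)
    (hb : (Fin (6 + 6) → Bool) → Bool) (hxZ : P xZ) (hPV : ∀ x, P x → ∀ a ∈ V₀, P (bxor x a))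
    (hsd : ∀ x, P x → ∀ p ∈ V₀, ∀ q ∈ V₀, hb (bxor (bxor x p) q) = (hb x ^^ hb (bxor x p) ^^ hb (bxor x q) ^^ (hb xZ ^^ hb (bxor xZ p) ^^ hb (bxor xZ q) ^^ hb (bxor (bxor xZ p) q))))
    {a b b' : Fin (6 + 6) → Bool} (ha : a ∈ V₀) (hb₁ : b ∈ V₀) (hb₂ : b' ∈ V₀) :
    (hb xZ ^^ hb (bxor xZ a) ^^ hb (bxor xZ (bxor b b')) ^^ hb (bxor (bxor xZ a) (bxor b b'))) = ((hb xZ ^^ hb (bxor xZ a) ^^ hb (bxor xZ b) ^^ hb (bxor (bxor xZ a) b)) ^^ (hb xZ ^^ hb (bxor xZ a) ^^ hb (bxor xZ b') ^^ hb (bxor (bxor xZ a) b'))) := by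
  rw [fr_B_symm xZ hb a (bxor b b'), fr_B_add_left V₀ P xZ hb hxZ hPV hsd hb₁ hb₂ ha, fr_B_symm xZ hb b a, fr_B_symm xZ hb b' a]

/-- **A `(1,0)`-vector for a pair**: if `p, p ⊕ q ∉ R` there is `v ∈ V₀` with `B(p,v) = 1`, `B(q,v) = 0`. [folklore] -/
theorem gf_pair10 (V₀ : Finset (Fin (6 + 6) → Bool)) (P : (Fin (6 + 6) → Bool) → Prop) (xZ : Fin (6 + 6) → Bool)
    (hb : (Fin (6 + 6) → Bool) → Bool) (hxZ : P xZ) (hPV : ∀ x, P x → ∀ a ∈ V₀, P (bxor x a))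
    (hadd : ∀ a ∈ V₀, ∀ b ∈ V₀, bxor a b ∈ V₀)
    (hsd : ∀ x, P x → ∀ p ∈ V₀, ∀ q ∈ V₀, hb (bxor (bxor x p) q) = (hb x ^^ hb (bxor x p) ^^ hb (bxor x q) ^^ (hb xZ ^^ hb (bxor xZ p) ^^ hb (bxor xZ q) ^^ hb (bxor (bxor xZ p) q))))
    {p q : Fin (6 + 6) → Bool} (hp : p ∈ V₀) (hq : q ∈ V₀) (hpR : p ∉ (V₀.filter fun r => ∀ v ∈ V₀, (hb xZ ^^ hb (bxor xZ r) ^^ hb (bxor xZ v) ^^ hb (bxor (bxor xZ r) v)) = false)) (hpqR : bxor p q ∉ (V₀.filter fun r => ∀ v ∈ V₀, (hb xZ ^^ hb (bxor xZ r) ^^ hb (bxor xZ v) ^^ hb (bxor (bxor xZ r) v)) = false)) :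
    ∃ v ∈ V₀, (hb xZ ^^ hb (bxor xZ p) ^^ hb (bxor xZ v) ^^ hb (bxor (bxor xZ p) v)) = true ∧ (hb xZ ^^ hb (bxor xZ q) ^^ hb (bxor xZ v) ^^ hb (bxor (bxor xZ q) v)) = false := by
  obtain ⟨v₁, hv₁, h1⟩ := gf_witness V₀ xZ hb hp hpR
  rcases Bool.eq_false_or_eq_true (hb xZ ^^ hb (bxor xZ q) ^^ hb (bxor xZ v₁) ^^ hb (bxor (bxor xZ q) v₁)) with hq1 | hq1
  swap
  · exact ⟨v₁, hv₁, h1, hq1⟩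
  obtain ⟨v₃, hv₃, h3⟩ := gf_witness V₀ xZ hb (hadd p hp q hq) hpqR
  rw [fr_B_add_left V₀ P xZ hb hxZ hPV hsd hp hq hv₃] at h3
  rcases Bool.eq_false_or_eq_true (hb xZ ^^ hb (bxor xZ p) ^^ hb (bxor xZ v₃) ^^ hb (bxor (bxor xZ p) v₃)) with hp3 | hp3
  · have hq3 : (hb xZ ^^ hb (bxor xZ q) ^^ hb (bxor xZ v₃) ^^ hb (bxor (bxor xZ q) v₃)) = false := by
      rw [hp3] at h3; revert h3; cases (hb xZ ^^ hb (bxor xZ q) ^^ hb (bxor xZ v₃) ^^ hb (bxor (bxor xZ q) v₃)) <;> decide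
    exact ⟨v₃, hv₃, hp3, hq3⟩
  · have hq3 : (hb xZ ^^ hb (bxor xZ q) ^^ hb (bxor xZ v₃) ^^ hb (bxor (bxor xZ q) v₃)) = true := by
      rw [hp3] at h3; revert h3; cases (hb xZ ^^ hb (bxor xZ q) ^^ hb (bxor xZ v₃) ^^ hb (bxor (bxor xZ q) v₃)) <;> decide
    refine ⟨bxor v₁ v₃, hadd v₁ hv₁ v₃ hv₃, ?_, ?_⟩
    · rw [gf_B_add_right V₀ P xZ hb hxZ hPV hsd hp hv₁ hv₃, h1, hp3]; decide
    · rw [gf_B_add_right V₀ P xZ hb hxZ hPV hsd hq hv₁ hv₃, hq1, hq3]; decide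

/-- **Projection onto `⟨p,q⟩^⊥` for a hyperbolic pair** (`B(p,q) = 1`): `w ↦ w ⊕ B(q,w)·p ⊕ B(p,w)·q` lands in `V₀` and is
`B`-orthogonal to `p` and `q`. [folklore] -/
theorem gf_proj (V₀ : Finset (Fin (6 + 6) → Bool)) (P : (Fin (6 + 6) → Bool) → Prop) (xZ : Fin (6 + 6) → Bool)
    (hb : (Fin (6 + 6) → Bool) → Bool) (h0 : zeroVec ∈ V₀) (hxZ : P xZ) (hPV : ∀ x, P x → ∀ a ∈ V₀, P (bxor x a))
    (hadd : ∀ a ∈ V₀, ∀ b ∈ V₀, bxor a b ∈ V₀)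
    (hsd : ∀ x, P x → ∀ p ∈ V₀, ∀ q ∈ V₀, hb (bxor (bxor x p) q) = (hb x ^^ hb (bxor x p) ^^ hb (bxor x q) ^^ (hb xZ ^^ hb (bxor xZ p) ^^ hb (bxor xZ q) ^^ hb (bxor (bxor xZ p) q))))
    {p q : Fin (6 + 6) → Bool} (hp : p ∈ V₀) (hq : q ∈ V₀) (hpq : (hb xZ ^^ hb (bxor xZ p) ^^ hb (bxor xZ q) ^^ hb (bxor (bxor xZ p) q)) = true) (w : Fin (6 + 6) → Bool) (hw : w ∈ V₀) :
    bxor (bxor w (fun j => (hb xZ ^^ hb (bxor xZ q) ^^ hb (bxor xZ w) ^^ hb (bxor (bxor xZ q) w)) && p j)) (fun j => (hb xZ ^^ hb (bxor xZ p) ^^ hb (bxor xZ w) ^^ hb (bxor (bxor xZ p) w)) && q j) ∈ V₀ ∧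
      (hb xZ ^^ hb (bxor xZ p) ^^ hb (bxor xZ (bxor (bxor w (fun j => (hb xZ ^^ hb (bxor xZ q) ^^ hb (bxor xZ w) ^^ hb (bxor (bxor xZ q) w)) && p j)) (fun j => (hb xZ ^^ hb (bxor xZ p) ^^ hb (bxor xZ w) ^^ hb (bxor (bxor xZ p) w)) && q j))) ^^ hb (bxor (bxor xZ p) (bxor (bxor w (fun j => (hb xZ ^^ hb (bxor xZ q) ^^ hb (bxor xZ w) ^^ hb (bxor (bxor xZ q) w)) && p j)) (fun j => (hb xZ ^^ hb (bxor xZ p) ^^ hb (bxor xZ w) ^^ hb (bxor (bxor xZ p) w)) && q j)))) = false ∧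
      (hb xZ ^^ hb (bxor xZ q) ^^ hb (bxor xZ (bxor (bxor w (fun j => (hb xZ ^^ hb (bxor xZ q) ^^ hb (bxor xZ w) ^^ hb (bxor (bxor xZ q) w)) && p j)) (fun j => (hb xZ ^^ hb (bxor xZ p) ^^ hb (bxor xZ w) ^^ hb (bxor (bxor xZ p) w)) && q j))) ^^ hb (bxor (bxor xZ q) (bxor (bxor w (fun j => (hb xZ ^^ hb (bxor xZ q) ^^ hb (bxor xZ w) ^^ hb (bxor (bxor xZ q) w)) && p j)) (fun j => (hb xZ ^^ hb (bxor xZ p) ^^ hb (bxor xZ w) ^^ hb (bxor (bxor xZ p) w)) && q j)))) = false := by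
  have hsymm := fr_B_symm xZ hb
  have m1 : (fun j => (hb xZ ^^ hb (bxor xZ q) ^^ hb (bxor xZ w) ^^ hb (bxor (bxor xZ q) w)) && p j) ∈ V₀ := fr_smul_mem V₀ h0 hp _
  have m2 : (fun j => (hb xZ ^^ hb (bxor xZ p) ^^ hb (bxor xZ w) ^^ hb (bxor (bxor xZ p) w)) && q j) ∈ V₀ := fr_smul_mem V₀ h0 hq _
  have hw1 : bxor w (fun j => (hb xZ ^^ hb (bxor xZ q) ^^ hb (bxor xZ w) ^^ hb (bxor (bxor xZ q) w)) && p j) ∈ V₀ := hadd _ hw _ m1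
  have hqp : (hb xZ ^^ hb (bxor xZ q) ^^ hb (bxor xZ p) ^^ hb (bxor (bxor xZ q) p)) = true := by rw [hsymm q p]; exact hpq
  refine ⟨hadd _ hw1 _ m2, ?_, ?_⟩
  · rw [gf_B_add_right V₀ P xZ hb hxZ hPV hsd hp hw1 m2, gf_B_add_right V₀ P xZ hb hxZ hPV hsd hp hw m1, gf_B_smul_right,
      gf_B_smul_right, fr_B_self xZ hb p, hpq]
    generalize (hb xZ ^^ hb (bxor xZ p) ^^ hb (bxor xZ w) ^^ hb (bxor (bxor xZ p) w)) = c₁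
    generalize (hb xZ ^^ hb (bxor xZ q) ^^ hb (bxor xZ w) ^^ hb (bxor (bxor xZ q) w)) = c₂
    revert c₁ c₂; decide
  · rw [gf_B_add_right V₀ P xZ hb hxZ hPV hsd hq hw1 m2, gf_B_add_right V₀ P xZ hb hxZ hPV hsd hq hw m1, gf_B_smul_right,
      gf_B_smul_right, fr_B_self xZ hb q, hqp]
    generalize (hb xZ ^^ hb (bxor xZ p) ^^ hb (bxor xZ w) ^^ hb (bxor (bxor xZ p) w)) = c₁
    generalize (hb xZ ^^ hb (bxor xZ q) ^^ hb (bxor xZ w) ^^ hb (bxor (bxor xZ q) w)) = c₂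
    revert c₁ c₂; decide

/-! ### A frame with Pfaffian `1` whose first two vectors lie in a given 64-element subgroup -/

/-- **A non-degenerate frame through `U`.**  If the radical `R` has `8` elements and `U ⊆ V₀` has `64` (`#V₀ = 512`), there are `p, q ∈ U` and
`a₂, a₃ ∈ V₀` with Gram–Pfaffian `B(q,p)B(a₃,a₂) ⊕ B(a₂,p)B(a₃,q) ⊕ B(a₃,p)B(a₂,q) = 1`. [this work] -/
theorem gf_frame (V₀ : Finset (Fin (6 + 6) → Bool)) (P : (Fin (6 + 6) → Bool) → Prop) (xZ : Fin (6 + 6) → Bool)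
    (hb : (Fin (6 + 6) → Bool) → Bool) (h0 : zeroVec ∈ V₀) (hxZ : P xZ) (hPV : ∀ x, P x → ∀ a ∈ V₀, P (bxor x a))
    (hadd : ∀ a ∈ V₀, ∀ b ∈ V₀, bxor a b ∈ V₀) (hcardV : #V₀ = 512)
    (hsd : ∀ x, P x → ∀ p ∈ V₀, ∀ q ∈ V₀, hb (bxor (bxor x p) q) = (hb x ^^ hb (bxor x p) ^^ hb (bxor x q) ^^ (hb xZ ^^ hb (bxor xZ p) ^^ hb (bxor xZ q) ^^ hb (bxor (bxor xZ p) q))))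
    (U : Finset (Fin (6 + 6) → Bool)) (hUV : U ⊆ V₀) (hUcard : #U = 64) (hR8 : #(V₀.filter fun r => ∀ v ∈ V₀, (hb xZ ^^ hb (bxor xZ r) ^^ hb (bxor xZ v) ^^ hb (bxor (bxor xZ r) v)) = false) = 8) :
    ∃ p ∈ U, ∃ q ∈ U, ∃ a₂ ∈ V₀, ∃ a₃ ∈ V₀, ((((hb xZ ^^ hb (bxor xZ q) ^^ hb (bxor xZ p) ^^ hb (bxor (bxor xZ q) p)) && (hb xZ ^^ hb (bxor xZ a₃) ^^ hb (bxor xZ a₂) ^^ hb (bxor (bxor xZ a₃) a₂))) ^^ ((hb xZ ^^ hb (bxor xZ a₂) ^^ hb (bxor xZ p) ^^ hb (bxor (bxor xZ a₂) p)) && (hb xZ ^^ hb (bxor xZ a₃) ^^ hb (bxor xZ q) ^^ hb (bxor (bxor xZ a₃) q))) ^^ ((hb xZ ^^ hb (bxor xZ a₃) ^^ hb (bxor xZ p) ^^ hb (bxor (bxor xZ a₃) p)) && (hb xZ ^^ hb (bxor xZ a₂) ^^ hb (bxor xZ q) ^^ hb (bxor (bxor xZ a₂) q))))) = true := by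
  classical
  set R := (V₀.filter fun r => ∀ v ∈ V₀, (hb xZ ^^ hb (bxor xZ r) ^^ hb (bxor xZ v) ^^ hb (bxor (bxor xZ r) v)) = false) with hRdef
  have hsymm := fr_B_symm xZ hb
  -- `p ∈ U ∖ R`, `q ∈ U ∖ (R ∪ p ⊕ R)`
  obtain ⟨p, hpU, hpR⟩ : ∃ p ∈ U, p ∉ R := by
    by_contra hno
    push Not at hno
    have := card_le_card (show U ⊆ R from fun x hx => hno x hx)
    omega
  have hp : p ∈ V₀ := hUV hpU
  obtain ⟨q, hqU, hqR⟩ : ∃ q ∈ U, q ∉ R ∪ R.image (bxor p) := by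
    by_contra hno
    push Not at hno
    have h1 := card_le_card (show U ⊆ R ∪ R.image (bxor p) from fun x hx => hno x hx)
    have h2 := card_union_le R (R.image (bxor p))
    have h3 : #(R.image (bxor p)) ≤ 8 := card_image_le.trans hR8.le
    omega
  rw [mem_union, not_or] at hqR
  have hq : q ∈ V₀ := hUV hqU
  have hpqR : bxor p q ∉ R := fun h => hqR.2 (mem_image.2 ⟨bxor p q, h, by rw [bxor_bxor_cancel_left]⟩)
  have hqpR : bxor q p ∉ R := by rw [bxor_comm]; exact hpqR
  refine ⟨p, hpU, q, hqU, ?_⟩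
  rcases Bool.eq_false_or_eq_true (hb xZ ^^ hb (bxor xZ p) ^^ hb (bxor xZ q) ^^ hb (bxor (bxor xZ p) q)) with hpq | hpq
  · -- `B(p,q) = 1`: a hyperbolic pair inside `⟨p,q⟩^⊥`
    have hFcard : #(((R ∪ R.image (fun r => bxor r q)) ∪ (R.image (fun r => bxor r p) ∪ R.image (fun r => bxor (bxor r q) p)))) ≤ 32 := by
      have h1 := card_union_le (R ∪ R.image (fun r => bxor r q)) (R.image (fun r => bxor r p) ∪ R.image (fun r => bxor (bxor r q) p))
      have h2 := card_union_le R (R.image (fun r => bxor r q))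
      have h3 := card_union_le (R.image (fun r => bxor r p)) (R.image (fun r => bxor (bxor r q) p))
      have h4 : #(R.image (fun r => bxor r q)) ≤ 8 := card_image_le.trans hR8.le
      have h5 : #(R.image (fun r => bxor r p)) ≤ 8 := card_image_le.trans hR8.le
      have h6 : #(R.image (fun r => bxor (bxor r q) p)) ≤ 8 := card_image_le.trans hR8.le
      omega
    set F := ((R ∪ R.image (fun r => bxor r q)) ∪ (R.image (fun r => bxor r p) ∪ R.image (fun r => bxor (bxor r q) p))) with hF
    obtain ⟨w₀, hw₀, hw₀F⟩ : ∃ w ∈ V₀, w ∉ F := by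
      by_contra hno
      push Not at hno
      have := card_le_card (show V₀ ⊆ F from fun x hx => hno x hx)
      omega
    obtain ⟨haV, hpa, hqa⟩ := gf_proj V₀ P xZ hb h0 hxZ hPV hadd hsd hp hq hpq w₀ hw₀
    set a := bxor (bxor w₀ (fun j => (hb xZ ^^ hb (bxor xZ q) ^^ hb (bxor xZ w₀) ^^ hb (bxor (bxor xZ q) w₀)) && p j)) (fun j => (hb xZ ^^ hb (bxor xZ p) ^^ hb (bxor xZ w₀) ^^ hb (bxor (bxor xZ p) w₀)) && q j) with hadef
    have haR : a ∉ R := by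
      intro haR'
      apply hw₀F
      have hw₀eq : w₀ = bxor (bxor a (fun j => (hb xZ ^^ hb (bxor xZ p) ^^ hb (bxor xZ w₀) ^^ hb (bxor (bxor xZ p) w₀)) && q j)) (fun j => (hb xZ ^^ hb (bxor xZ q) ^^ hb (bxor xZ w₀) ^^ hb (bxor (bxor xZ q) w₀)) && p j) := by
        simp only [a]
        generalize (hb xZ ^^ hb (bxor xZ p) ^^ hb (bxor xZ w₀) ^^ hb (bxor (bxor xZ p) w₀)) = c₁
        generalize (hb xZ ^^ hb (bxor xZ q) ^^ hb (bxor xZ w₀) ^^ hb (bxor (bxor xZ q) w₀)) = c₂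
        funext j
        simp only [bxor]
        cases c₁ <;> cases c₂ <;> cases w₀ j <;> cases p j <;> cases q j <;> rfl
      rw [hF, mem_union, mem_union, mem_union]
      rcases Bool.eq_false_or_eq_true (hb xZ ^^ hb (bxor xZ p) ^^ hb (bxor xZ w₀) ^^ hb (bxor (bxor xZ p) w₀)) with c1 | c1 <;> rcases Bool.eq_false_or_eq_true (hb xZ ^^ hb (bxor xZ q) ^^ hb (bxor xZ w₀) ^^ hb (bxor (bxor xZ q) w₀)) with c2 | c2
      · right; right
        refine mem_image.2 ⟨a, haR', ?_⟩
        rw [hw₀eq, c1, c2]; funext j; simp [bxor]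
      · left; right
        refine mem_image.2 ⟨a, haR', ?_⟩
        rw [hw₀eq, c1, c2]; funext j; simp [bxor]
      · right; left
        refine mem_image.2 ⟨a, haR', ?_⟩
        rw [hw₀eq, c1, c2]; funext j; simp [bxor]
      · left; left
        have : w₀ = a := by rw [hw₀eq, c1, c2]; funext j; simp [bxor]
        rw [this]; exact haR'
    obtain ⟨v, hv, hav⟩ := gf_witness V₀ xZ hb haV haR
    obtain ⟨hbV, hpb, hqb⟩ := gf_proj V₀ P xZ hb h0 hxZ hPV hadd hsd hp hq hpq v hv
    set b := bxor (bxor v (fun j => (hb xZ ^^ hb (bxor xZ q) ^^ hb (bxor xZ v) ^^ hb (bxor (bxor xZ q) v)) && p j)) (fun j => (hb xZ ^^ hb (bxor xZ p) ^^ hb (bxor xZ v) ^^ hb (bxor (bxor xZ p) v)) && q j) with hbdef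
    have hab : (hb xZ ^^ hb (bxor xZ a) ^^ hb (bxor xZ b) ^^ hb (bxor (bxor xZ a) b)) = true := by
      have m1 : (fun j => (hb xZ ^^ hb (bxor xZ q) ^^ hb (bxor xZ v) ^^ hb (bxor (bxor xZ q) v)) && p j) ∈ V₀ := fr_smul_mem V₀ h0 hp _
      have m2 : (fun j => (hb xZ ^^ hb (bxor xZ p) ^^ hb (bxor xZ v) ^^ hb (bxor (bxor xZ p) v)) && q j) ∈ V₀ := fr_smul_mem V₀ h0 hq _
      have hv1 : bxor v (fun j => (hb xZ ^^ hb (bxor xZ q) ^^ hb (bxor xZ v) ^^ hb (bxor (bxor xZ q) v)) && p j) ∈ V₀ := hadd _ hv _ m1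
      have hap : (hb xZ ^^ hb (bxor xZ a) ^^ hb (bxor xZ p) ^^ hb (bxor (bxor xZ a) p)) = false := by rw [hsymm a p]; exact hpa
      have haq : (hb xZ ^^ hb (bxor xZ a) ^^ hb (bxor xZ q) ^^ hb (bxor (bxor xZ a) q)) = false := by rw [hsymm a q]; exact hqa
      show (hb xZ ^^ hb (bxor xZ a) ^^ hb (bxor xZ (bxor (bxor v (fun j => (hb xZ ^^ hb (bxor xZ q) ^^ hb (bxor xZ v) ^^ hb (bxor (bxor xZ q) v)) && p j)) (fun j => (hb xZ ^^ hb (bxor xZ p) ^^ hb (bxor xZ v) ^^ hb (bxor (bxor xZ p) v)) && q j))) ^^ hb (bxor (bxor xZ a) (bxor (bxor v (fun j => (hb xZ ^^ hb (bxor xZ q) ^^ hb (bxor xZ v) ^^ hb (bxor (bxor xZ q) v)) && p j)) (fun j => (hb xZ ^^ hb (bxor xZ p) ^^ hb (bxor xZ v) ^^ hb (bxor (bxor xZ p) v)) && q j)))) = true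
      rw [gf_B_add_right V₀ P xZ hb hxZ hPV hsd haV hv1 m2, gf_B_add_right V₀ P xZ hb hxZ hPV hsd haV hv m1, gf_B_smul_right,
        gf_B_smul_right, hap, haq, hav]
      generalize (hb xZ ^^ hb (bxor xZ p) ^^ hb (bxor xZ v) ^^ hb (bxor (bxor xZ p) v)) = c₁
      generalize (hb xZ ^^ hb (bxor xZ q) ^^ hb (bxor xZ v) ^^ hb (bxor (bxor xZ q) v)) = c₂
      revert c₁ c₂; decide
    refine ⟨a, haV, b, hbV, ?_⟩
    have hqp : (hb xZ ^^ hb (bxor xZ q) ^^ hb (bxor xZ p) ^^ hb (bxor (bxor xZ q) p)) = true := by rw [hsymm q p]; exact hpq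
    have hba : (hb xZ ^^ hb (bxor xZ b) ^^ hb (bxor xZ a) ^^ hb (bxor (bxor xZ b) a)) = true := by rw [hsymm b a]; exact hab
    have hbp : (hb xZ ^^ hb (bxor xZ b) ^^ hb (bxor xZ p) ^^ hb (bxor (bxor xZ b) p)) = false := by rw [hsymm b p]; exact hpb
    have hap' : (hb xZ ^^ hb (bxor xZ a) ^^ hb (bxor xZ p) ^^ hb (bxor (bxor xZ a) p)) = false := by rw [hsymm a p]; exact hpa
    rw [hqp, hba, hap', hbp]
    generalize (hb xZ ^^ hb (bxor xZ b) ^^ hb (bxor xZ q) ^^ hb (bxor (bxor xZ b) q)) = c₁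
    generalize (hb xZ ^^ hb (bxor xZ a) ^^ hb (bxor xZ q) ^^ hb (bxor (bxor xZ a) q)) = c₂
    revert c₁ c₂; decide
  · -- `B(p,q) = 0`: `(1,0)`- and `(0,1)`-vectors
    obtain ⟨p', hp', h1, h2⟩ := gf_pair10 V₀ P xZ hb hxZ hPV hadd hsd hp hq hpR hpqR
    obtain ⟨q', hq', h3, h4⟩ := gf_pair10 V₀ P xZ hb hxZ hPV hadd hsd hq hp hqR.1 hqpR
    refine ⟨p', hp', q', hq', ?_⟩
    have hqp : (hb xZ ^^ hb (bxor xZ q) ^^ hb (bxor xZ p) ^^ hb (bxor (bxor xZ q) p)) = false := by rw [hsymm q p]; exact hpq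
    have hp'p : (hb xZ ^^ hb (bxor xZ p') ^^ hb (bxor xZ p) ^^ hb (bxor (bxor xZ p') p)) = true := by rw [hsymm p' p]; exact h1
    have hq'q : (hb xZ ^^ hb (bxor xZ q') ^^ hb (bxor xZ q) ^^ hb (bxor (bxor xZ q') q)) = true := by rw [hsymm q' q]; exact h3
    have hq'p : (hb xZ ^^ hb (bxor xZ q') ^^ hb (bxor xZ p) ^^ hb (bxor (bxor xZ q') p)) = false := by rw [hsymm q' p]; exact h4
    have hp'q : (hb xZ ^^ hb (bxor xZ p') ^^ hb (bxor xZ q) ^^ hb (bxor (bxor xZ p') q)) = false := by rw [hsymm p' q]; exact h2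
    rw [hqp, hp'p, hq'q, hq'p, hp'q]
    generalize (hb xZ ^^ hb (bxor xZ q') ^^ hb (bxor xZ p') ^^ hb (bxor (bxor xZ q') p')) = c₁
    revert c₁; decide

/-! ### The rank-6 kill -/

/-- **Rank 6 is impossible in configuration (γ).**  See the module docstring. [this work] -/
theorem gf_rank_six_false (f g : (Fin (6 + 6) → Bool) → Bool) (hf : IsDegLeFun 3 f) (hg : IsDegLeFun 3 g)
    (u'' : (Fin (6 + 6) → Bool) → ℤ) (hu'' : ∀ x, W (fun y => signOf (g y)) x = (2 : ℝ) ^ 6 * (u'' x : ℝ))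
    (V₀ : Finset (Fin (6 + 6) → Bool)) (xZ : Fin (6 + 6) → Bool) (h0 : zeroVec ∈ V₀) (hadd : ∀ a ∈ V₀, ∀ b ∈ V₀, bxor a b ∈ V₀)
    (hcardV : #V₀ = 512) (hS : (univ.filter fun x : Fin (6 + 6) → Bool => ¬ Odd (u'' x)) = V₀.image (bxor xZ))
    (hoff : ∑ y ∈ univ.filter (fun y => y ∉ (univ.filter fun x : Fin (6 + 6) → Bool => ¬ Odd (u'' x))), (u'' y - sZ (f y)) ^ 2 ≤ 256)
    (hb : (Fin (6 + 6) → Bool) → Bool)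
    (hhb : ∀ x ∈ (univ.filter fun x : Fin (6 + 6) → Bool => ¬ Odd (u'' x)), sZ (hb x) = u'' x - sZ (f x))
    (U : Finset (Fin (6 + 6) → Bool)) (hUV : U ⊆ V₀) (hU0 : zeroVec ∈ U) (hUadd : ∀ a ∈ U, ∀ b ∈ U, bxor a b ∈ U)
    (hUcard : #U = 64) (m₀ : Fin (6 + 6) → Bool) (hm₀ : m₀ ∉ (univ.filter fun x : Fin (6 + 6) → Bool => ¬ Odd (u'' x)))
    (hM0 : ∀ y, y ∉ (univ.filter fun x : Fin (6 + 6) → Bool => ¬ Odd (u'' x)) → y ∉ U.image (bxor m₀) → u'' y - sZ (f y) = 0)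
    (hR8 : #(V₀.filter fun r => ∀ v ∈ V₀, (hb xZ ^^ hb (bxor xZ r) ^^ hb (bxor xZ v) ^^ hb (bxor (bxor xZ r) v)) = false) = 8) : False := by
  classical
  set Z := (univ.filter fun x : Fin (6 + 6) → Bool => ¬ Odd (u'' x)) with hZdef
  set e : (Fin (6 + 6) → Bool) → ℤ := fun x => u'' x - sZ (f x) with hedef
  have hxZ : xZ ∈ Z := by rw [hS]; exact mem_image.2 ⟨zeroVec, h0, bxor_zeroVec xZ⟩
  have hPV : ∀ x, x ∈ Z → ∀ a ∈ V₀, bxor x a ∈ Z := fun x hx a ha => fl1_coset_vadd hadd hS hx ha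
  have hVP : ∀ x, x ∈ Z → bxor xZ x ∈ V₀ := fun x hx => fl1_coset_diff hS hx
  have hsZ : ∀ x ∈ Z, sZ (hb x) = e x := hhb
  change ∀ y, y ∉ Z → y ∉ U.image (bxor m₀) → e y = 0 at hM0
  -- (H3) for `σ = sZ ∘ hb` on `Z`, hence base-free second differences
  have H3e := gh_H3 f g hf hg u'' hu'' V₀ xZ h0 hadd hcardV hS hoff
  have H3σ : ∀ x, x ∈ Z → ∀ a b c : Fin (6 + 6) → Bool, a ∈ V₀ → b ∈ V₀ → c ∈ V₀ →
      (4 : ℤ) ∣ ∑ ε : Fin 3 → Bool, sZ (hb (fun j => x j ^^ decide (Odd #(univ.filter fun i => ε i && (![a, b, c] : Fin 3 → Fin (6 + 6) → Bool) i j)))) := by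
    intro x hx a b c ha hb' hc'
    have hmem : ∀ ε : Fin 3 → Bool, (fun j => x j ^^ decide (Odd #(univ.filter fun i => ε i && (![a, b, c] : Fin 3 → Fin (6 + 6) → Bool) i j))) ∈ Z :=
      fun ε => fr_mem_flatPt3 V₀ h0 (· ∈ Z) hPV hx _ (fun i => by fin_cases i <;> assumption) ε
    rw [sum_congr rfl fun ε _ => hsZ _ (hmem ε)]
    exact H3e x hx a b c ha hb' hc'
  have hsd := fr_hsd V₀ (· ∈ Z) xZ hxZ hVP hb H3σ
  -- the frame
  obtain ⟨p, hpU, q, hqU, a₂, ha₂, a₃, ha₃, hPf⟩ := gf_frame V₀ (· ∈ Z) xZ hb h0 hxZ hPV hadd hcardV hsd U hUV hUcard hR8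
  have hp : p ∈ V₀ := hUV hpU
  have hq : q ∈ V₀ := hUV hqU
  -- the 4-flat sign sum `≡ 4 (mod 8)`
  have hws := ws_sum4_mod8 V₀ (· ∈ Z) xZ hb hPV hsd hxZ hp hq ha₂ ha₃
  rw [if_pos hPf] at hws
  have hin : ∀ ε : Fin 4 → Bool, (fun j => xZ j ^^ decide (Odd #(univ.filter fun i => ε i && (![p, q, a₂, a₃] : Fin 4 → Fin (6 + 6) → Bool) i j))) ∈ Z :=
    fun ε => fr_mem_flatPt4 V₀ h0 (· ∈ Z) hPV hxZ ![p, q, a₂, a₃] (fun i => by fin_cases i <;> assumption) ε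
  -- a translate `q₀ ⊕ ⟨p,q,a₂,a₃⟩` in the coset of `m₀` missing `m₀ ⊕ U`
  set Fv := (univ : Finset (Bool × Bool)).biUnion
    (fun cc => U.image (fun u => bxor u (bxor (fun j => cc.1 && a₂ j) (fun j => cc.2 && a₃ j)))) with hFv
  have hFvcard : #Fv ≤ 256 := by
    calc #Fv ≤ ∑ cc : Bool × Bool, #(U.image (fun u => bxor u (bxor (fun j => cc.1 && a₂ j) (fun j => cc.2 && a₃ j)))) := card_biUnion_le
      _ ≤ ∑ cc : Bool × Bool, #U := sum_le_sum fun cc _ => card_image_le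
      _ = 256 := by rw [sum_const, card_univ, hUcard]; simp
  obtain ⟨v, hvV, hvF⟩ : ∃ v ∈ V₀, v ∉ Fv := by
    by_contra hno
    push Not at hno
    have := card_le_card (show V₀ ⊆ Fv from fun x hx => hno x hx)
    omega
  set q₀ := bxor m₀ v with hq₀
  have hq₀Z : q₀ ∉ Z := fl1_coset_out' hadd hS hm₀ hvV
  set t₁ := bxor xZ q₀ with ht₁
  -- family `t₁`: the translate `q₀ ⊕ ⟨p,q,a₂,a₃⟩` is off `Z` and misses `m₀ ⊕ U`
  have hfam1 : ∀ ε : Fin 4 → Bool, bxor (fun j => xZ j ^^ decide (Odd #(univ.filter fun i => ε i && (![p, q, a₂, a₃] : Fin 4 → Fin (6 + 6) → Bool) i j))) t₁ ∉ Z ∧ bxor (fun j => xZ j ^^ decide (Odd #(univ.filter fun i => ε i && (![p, q, a₂, a₃] : Fin 4 → Fin (6 + 6) → Bool) i j))) t₁ ∉ U.image (bxor m₀) := by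
    intro ε
    have hp₀ : (fun j => zeroVec j ^^ decide (Odd #(univ.filter fun i => ε i && (![p, q, a₂, a₃] : Fin 4 → Fin (6 + 6) → Bool) i j))) ∈ V₀ :=
      ws_flatPt_mem V₀ h0 (· ∈ V₀) (fun x hx a ha => hadd x hx a ha) 4 zeroVec h0 ![p, q, a₂, a₃]
        (fun i => by fin_cases i <;> assumption) ε
    have ept : bxor (fun j => xZ j ^^ decide (Odd #(univ.filter fun i => ε i && (![p, q, a₂, a₃] : Fin 4 → Fin (6 + 6) → Bool) i j))) t₁ = bxor q₀ (fun j => zeroVec j ^^ decide (Odd #(univ.filter fun i => ε i && (![p, q, a₂, a₃] : Fin 4 → Fin (6 + 6) → Bool) i j))) := by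
      rw [ws_flatPt_eq_bxor xZ]
      simp only [t₁]
      generalize (fun j => zeroVec j ^^ decide (Odd #(univ.filter fun i => ε i && (![p, q, a₂, a₃] : Fin 4 → Fin (6 + 6) → Bool) i j))) = p₀
      funext j; simp only [bxor]; cases xZ j <;> cases q₀ j <;> cases p₀ j <;> rfl
    rw [ept]
    refine ⟨fl1_coset_out' hadd hS hq₀Z hp₀, fun hmem => hvF ?_⟩
    obtain ⟨u', hu', hu'eq⟩ := mem_image.1 hmem
    have hv_eq : v = bxor u' (fun j => zeroVec j ^^ decide (Odd #(univ.filter fun i => ε i && (![p, q, a₂, a₃] : Fin 4 → Fin (6 + 6) → Bool) i j))) := by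
      have h1 : bxor m₀ u' = bxor (bxor m₀ v) (fun j => zeroVec j ^^ decide (Odd #(univ.filter fun i => ε i && (![p, q, a₂, a₃] : Fin 4 → Fin (6 + 6) → Bool) i j))) := hu'eq
      generalize (fun j => zeroVec j ^^ decide (Odd #(univ.filter fun i => ε i && (![p, q, a₂, a₃] : Fin 4 → Fin (6 + 6) → Bool) i j))) = p₀ at h1 ⊢
      funext j
      have := congrFun h1 j
      simp only [bxor] at this ⊢
      revert this
      cases m₀ j <;> cases u' j <;> cases v j <;> cases p₀ j <;> decide
    rw [hFv, mem_biUnion]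
    refine ⟨(ε 2, ε 3), mem_univ _, mem_image.2 ⟨bxor (bxor u' (fun j => ε 0 && p j)) (fun j => ε 1 && q j), ?_, ?_⟩⟩
    · exact hUadd _ (hUadd _ hu' _ (fr_smul_mem U hU0 hpU (ε 0))) _ (fr_smul_mem U hU0 hqU (ε 1))
    · rw [hv_eq, es_flatPt_four zeroVec ![p, q, a₂, a₃] ε]
      have e0 : (![p, q, a₂, a₃] : Fin 4 → Fin (6 + 6) → Bool) 0 = p := rfl
      have e1 : (![p, q, a₂, a₃] : Fin 4 → Fin (6 + 6) → Bool) 1 = q := rfl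
      have e2 : (![p, q, a₂, a₃] : Fin 4 → Fin (6 + 6) → Bool) 2 = a₂ := rfl
      have e3 : (![p, q, a₂, a₃] : Fin 4 → Fin (6 + 6) → Bool) 3 = a₃ := rfl
      simp only [e0, e1, e2, e3]
      funext j
      simp only [bxor, zeroVec]
      cases u' j <;> cases (ε 0 && p j) <;> cases (ε 1 && q j) <;> cases (ε 2 && a₂ j) <;> cases (ε 3 && a₃ j) <;> rfl
  -- the forbidden set for the outer directions: `V₀ ∪ (x_Z ⊕ m₀) ⊕ V₀`; it is `t₁`-invariant
  set c₁ := bxor xZ m₀ with hc₁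
  set F₂ := V₀ ∪ V₀.image (bxor c₁) with hF₂
  have hF₂card : #F₂ ≤ 1024 := (card_union_le _ _).trans (by rw [hcardV]; exact Nat.add_le_add_left (card_image_le.trans hcardV.le) _)
  have hgoodF : ∀ t, t ∉ F₂ → ∀ y ∈ Z, bxor y t ∉ Z ∧ bxor y t ∉ U.image (bxor m₀) := by
    intro t ht y hy
    rw [hF₂, mem_union, not_or] at ht
    refine ⟨fl1_coset_out h0 hadd hS hy ht.1, fun hmem => ht.2 ?_⟩
    obtain ⟨u', hu', hueq⟩ := mem_image.1 hmem
    have hy' := hy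
    rw [hS] at hy'
    obtain ⟨w, hw, hweq⟩ := mem_image.1 hy'
    refine mem_image.2 ⟨bxor w u', hadd w hw u' (hUV hu'), ?_⟩
    funext j
    have h1 := congrFun hueq j
    have h2 := congrFun hweq j
    simp only [bxor, c₁] at h1 h2 ⊢
    revert h1 h2
    cases xZ j <;> cases m₀ j <;> cases w j <;> cases u' j <;> cases t j <;> cases y j <;> decide
  have ht₁c : t₁ = bxor c₁ v := by
    simp only [t₁, q₀, c₁]; funext j; simp only [bxor]; cases xZ j <;> cases m₀ j <;> cases v j <;> rfl
  have hinv : ∀ t, t ∉ F₂ → bxor t t₁ ∉ F₂ := by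
    intro t ht hmem
    apply ht
    rw [hF₂, mem_union] at hmem ⊢
    rcases hmem with h | h
    · right
      refine mem_image.2 ⟨bxor (bxor t t₁) v, hadd _ h _ hvV, ?_⟩
      rw [ht₁c]; funext j; simp only [bxor]; cases c₁ j <;> cases t j <;> cases v j <;> rfl
    · left
      obtain ⟨w, hw, hweq⟩ := mem_image.1 h
      have : t = bxor w v := by
        rw [ht₁c] at hweq
        funext j; have := congrFun hweq j; simp only [bxor] at this ⊢; revert this
        cases c₁ j <;> cases w j <;> cases t j <;> cases v j <;> decide
      rw [this]; exact hadd w hw v hvV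
  have huniv : #(univ : Finset (Fin (6 + 6) → Bool)) = 4096 := by
    rw [card_univ, Fintype.card_fun, Fintype.card_bool, Fintype.card_fin]; norm_num
  obtain ⟨t₂, -, ht₂⟩ : ∃ t, t ∈ univ ∧ t ∉ F₂ := exists_mem_notMem_of_card_lt_card (by rw [huniv]; omega)
  obtain ⟨t₃, -, ht₃⟩ : ∃ t, t ∈ univ ∧ t ∉ F₂ ∪ F₂.image (fun z => bxor z t₂) :=
    exists_mem_notMem_of_card_lt_card (by
      have h1 := card_union_le F₂ (F₂.image (fun z => bxor z t₂))
      have h2 : #(F₂.image (fun z => bxor z t₂)) ≤ 1024 := card_image_le.trans hF₂card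
      rw [huniv]; omega)
  rw [mem_union, not_or] at ht₃
  have ht₃₂ : bxor t₃ t₂ ∉ F₂ := fun hmem =>
    ht₃.2 (mem_image.2 ⟨bxor t₃ t₂, hmem, by rw [iw_bxor_assoc, bxor_self, bxor_zeroVec]⟩)
  have hzero : ∀ t, t ∉ F₂ → ∀ ε : Fin 4 → Bool, e (bxor (fun j => xZ j ^^ decide (Odd #(univ.filter fun i => ε i && (![p, q, a₂, a₃] : Fin 4 → Fin (6 + 6) → Bool) i j))) t) = 0 :=
    fun t ht ε => hM0 _ (hgoodF t ht _ (hin ε)).1 (hgoodF t ht _ (hin ε)).2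
  -- localisation: the 7-flat sum equals the 4-flat sum
  have hloc := ep_loc3 e xZ t₁ t₂ t₃ ![p, q, a₂, a₃]
    (fun ε => hM0 _ (hfam1 ε).1 (hfam1 ε).2)
    (fun ε => hzero t₂ ht₂ ε)
    (fun ε => by rw [iw_bxor_assoc]; exact hzero _ (hinv t₂ ht₂) ε)
    (fun ε => hzero t₃ ht₃.1 ε)
    (fun ε => by rw [iw_bxor_assoc]; exact hzero _ (hinv t₃ ht₃.1) ε)
    (fun ε => by rw [iw_bxor_assoc]; exact hzero _ ht₃₂ ε)
    (fun ε => by rw [iw_bxor_assoc, iw_bxor_assoc, ← iw_bxor_assoc t₃ t₂ t₁]; exact hzero _ (hinv _ ht₃₂) ε)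
  have h8 := tw15_e_flat7 f g hf hg u'' hu'' xZ ![t₁, t₂, t₃, p, q, a₂, a₃]
  change (8 : ℤ) ∣ ∑ ε : Fin (4 + 3) → Bool, e (fun j => xZ j ^^ decide (Odd #(univ.filter fun i =>
      ε i && (Matrix.vecCons t₁ (Matrix.vecCons t₂ (Matrix.vecCons t₃ ![p, q, a₂, a₃])) : Fin (4 + 3) → Fin (6 + 6) → Bool) i j))) at h8
  rw [hloc] at h8
  rw [sum_congr rfl fun ε _ => (hsZ _ (hin ε)).symm] at h8
  obtain ⟨c, hc⟩ := h8
  rw [hc] at hws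
  omega

end Summit.QuantumAdvantage.QuantumAdvantage.Theorems.CubicForrelation.NearExactIsExact

end
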